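import Summits.HubbardSuperconductivity.HubbardLadder.PairCorrSectorAssembly
import Summits.HubbardSuperconductivity.HubbardLadder.Bounds.TorusTTPrimeRows4x4
import Summits.HubbardSuperconductivity.HubbardLadder.HubbardDopedTPrimeSectorGlue
import Literature.MathematicalPhysics.QuantumLattice.PairChirality
import HarnessLib

/-!
# Rung R3 (finite-L, WEAK) — `pairrows1-min` UPPER half-row on `16·P̄_d(4,(2,2))` at `t' = -1/4`
# (`4 × 4` torus, `t = 1`, `U = 8`, `N = 14`), keyed BY NAME to `Bounds.torusTTUpper_tup_4x4_U8_N14_tpm1o4`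

HONEST FRAMING: ladder R1–R4 with certified numbers; no claim on H/H₀.

HONEST LABEL: TYPED CLAIM, reader-certified (A ∧ B of record), UNSIGNED until the referee replay 'ref-pairrows1-replay'; WEAK (4 × 4 is ED-able; finite torus, not the thermodynamic limit; the ceiling 0.8243971/site is ≈ 60× the float ED value 0.013772/site (NON-RIGOROUS orientation, kit j110329) and within ×1.5 of the Cauchy–Schwarz-type bound from the on-site pair density — near-vacuous as a bound; its content is the measured METHOD CEILING of d2 + eom4, R3-DESIGN §26; no dichotomy attempted; R3 NOT reached). The claim node below types ONE harvested certsdp/1 SECTOR-mode certificate (legacy path; ideal `N̂ − 14`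
only, i.e. one certificate for EVERY `S^z = M`; `objective_h0_coeff 0`; `objective_extra {"pair_dd": [{"r": [2,2], "coeff": "-1"}]}` = `−V_(2,2)` (`pairListObjective 4 (fun _ => -1) (fun _ => ![2,2])`, `V_r = pairCorrSym 4 r = ½(O_r + O_rᴴ)`, `O_r = pairCorrOp 4 r = Σ_x Δ_x†Δ_{x+r}`); ONE node-named `energy_upper` row
`u` = `Bounds.torusTTUpper_tup_4x4_U8_N14_tpm1o4` = −6757592964053/2³⁹ (REFEREE item 73 signed)) with `claimed.E_cert = -7973079329042861096893575/604462909807314587353088` — eng-1 kit j126332, spec `hub_torus4x4_U8_N14_tp-1o4_b4eom_PDD22up`, file `pub-hubbard/certs/pairrows1/N14.tpm1o4.PDD22up/cert_hub_torus4x4_U8_N14_tp-1o4_b4eom_PDD22up.json.gz`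
(sha256 `f18e7e43ef7d9f896d78e1dbd77b2390cbf8a688718bec5d723624fc3acbf4a9`; canonical cert sha256 `6521e7bd3765a28a359118838d26accf8470c0757ae00ff98f50d27a32859b30`); engine certsdp certsdp/0.4.3 (cell pub-mbboot); producer rows = eng-sdp-1 stage pairdd_hook + pairdd (sha-pinned in eng-1's job); t′ adapter hubbard_engA; basis degree<=2 + bond<=4 + eom4, polish False, m = 5873, nvar = 2418, n_eq = 80;
reader B: reader B OF RECORD verify_b 0.5.7 ACCEPT ok∧equal (E_recomputed = E_claimed = claimed.E_cert digit for digit; sha256 recomputed = cert sha; 404.029 s; file verifyB_hub_torus4x4_U8_N14_tp-1o4_b4eom_PDD22up.json) (eng-1 l.981, hub-side, DEFAULT policy, pair_dd ADMITTED R-265(d), checks 12/12); reader A: reader A OF RECORD = LIVE reader A 1.2.6 (certsdp.verify_a/0.3.9+mbboot-adapter; eng-1 l.998 2026-08-21T10:16:26Z) verdict ok ∧ equal, verdict ok on the file's own claim (compared_with claimed.also.E_cert; 104.773 s; file verifyA_hub_torus4x4_U8_N14_tp-1o4_b4eom_PDD22up.json); lower_bound == claimed.also.E_cert = −1993269816598517684213801/2⁷⁷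 (the reduce twin; Δ to the sector constant claimed.E_cert = 1.04e−7, claimed.E_cert the weaker = the number of record); 15/15 checks; PD of record kit j128126 `certs/pairrows1/pd/…pd.json.gz` sha256(gz) f1751aa64cca9d88… — caveat (NUMERICS §6): problem data from the same e1 generator lineage, not an independent transcription; engines-independent problem-data identity: pseudo l.980 ALL EQUAL + r3 C1–C6 l.976. Lead line: LEAD LINE (HH) 2026-08-21T07:11:14Z / (HH″) 07:16:38Z / (KK) 07:46:34Z (pairrows1-min, case 1 GO self-executing) / (QQ) 2026-08-21T09:26:29Z (reading of record adopted; case 2 NOT released — pairrows1 ENDS at case 1; verdict path (3)) / lead booking l.982 09:32:33Z.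

ROW (all `S^z`; self-contained — §0 below re-proves the `(N↑,N↓)`-neutrality of the `pair_dd` objective (= #188 §1, private
copies) and applies the in-tree all-`S^z` edge `re_expect_ge_of_sectorObsCertsTT'` (R2 device D31)): for EVERY normalised
`N = 14` ground state `ψ` of `hubbardTorusTT' 4 1 (-1/4) 8`, `S^z`-eigen or not: `16 · P̄_d(4,(2,2); ψ) ≤ -claimed.E_cert`
(≤ 13.1903533, outward 7 dp); and the `S^z = 0`-SECTOR reading of the same certificate (`M = 0` member, #116
`TorusSectorObsCertTT'.re_expect_ge` + Lieb's `S^z = 0` representative of `E₁₄`) as a further theorem;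
display form `P̄_d(4,(2,2); ψ) ≤ 0.8243971` (outward 7-dp rounding of -q/16 = 0.824397080).
P60 (a) containment (float ED orientation of record, R3-PAIRROWS-SPEC §11(e)): -q = 13.1903533 >= 0.22035 (16·P̄_d float value) — PASS.
Result line (iii) of record is unchanged by this row: no R3 instance has been run as a dichotomy; no dichotomy is certified at any
size; there are no brackets to overlap (R3-DESIGN §24: one-sided ceilings only, by design of (HH″)).

References: certificate TYPE and kernel edge — Wang et al. (2024) §3 eq. (obsopt), Han (2020) §2; sector structure — Lieb, PRL 62
(1989) 1201; `P̄_d` — Qin et al., PRX 10 (2020) 031016 §II eqs. (2)–(4).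
-/

noncomputable section

namespace Summit.HubbardSuperconductivity.HubbardLadder

open Matrix Literature.MathematicalPhysics.QuantumLattice Literature.Probability.LatticeModels
open Finset hiding expect
open Bounds
open scoped ComplexOrder

/-- **CLAIM NODE `pairrows1.PDD22up.tpm1o4`** (eng-1 kit j126332; file `pub-hubbard/certs/pairrows1/N14.tpm1o4.PDD22up/cert_hub_torus4x4_U8_N14_tp-1o4_b4eom_PDD22up.json.gz`, sha256 `f18e7e43ef7d9f896d78e1dbd77b2390cbf8a688718bec5d723624fc3acbf4a9`; certsdp/1 SECTOR mode
(legacy path), ideal `N̂ − 14`, objective `−V_(2,2)`, `objective_h0_coeff 0`, one `energy_upper` row `u` = `torusTTUpper_tup_4x4_U8_N14_tpm1o4` verbatim;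
`claimed.E_cert = -7973079329042861096893575/604462909807314587353088`): for every `M`, a sector-mode certificate for `−V_(2,2)` with value `claimed.E_cert`.
TYPED CLAIM, reader-certified (A ∧ B of record), UNSIGNED until the referee replay 'ref-pairrows1-replay'; WEAK (4 × 4 is ED-able; finite torus, not the thermodynamic limit; the ceiling 0.8243971/site is ≈ 60× the float ED value 0.013772/site (NON-RIGOROUS orientation, kit j110329) and within ×1.5 of the Cauchy–Schwarz-type bound from the on-site pair density — near-vacuous as a bound; its content is the measured METHOD CEILING of d2 + eom4, R3-DESIGN §26; no dichotomy attempted; R3 NOT reached). HONEST FRAMING: ladder R1–R4 with certified numbers; no claim on H/H₀. [cite: WangEtAl2024, §3 eq. (obsopt)] -/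
@[conjecture] def pairrowsPDDup_engA_4x4_U8_N14_tpm1o4 : Prop :=
  ∀ M : ℝ, Nonempty (TorusSectorObsCertTT' 4 1 (-1/4) 8 14 M ((-6757592964053 : ℝ) / 2 ^ 39)
    (pairListObjective 4 (fun _ : Fin 1 => (-1 : ℝ)) (fun _ => (![2, 2] : Site 2))) ((-7973079329042861096893575 : ℝ) / 2 ^ 79))

/-! ## §0 `(N↑, N↓)`-neutrality of the `pair_dd` objectives (private copies of #188 §1; [cite: Tasaki2020, §9.3]) -/

/-- `O_r = Σ_x Δ_x† Δ_{x+r}` has grade `(0, 0)`. [cite: Tasaki2020, §9.3] -/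
private theorem pr1_shifts_pairCorrOp (L : ℕ) [NeZero L] (r : Site 2) :
    PairChirality.Shifts 0 0 (pairCorrOp L r) := by
  unfold pairCorrOp
  refine PairChirality.Shifts.sum fun x _ => ?_
  have h := (PairChirality.shifts_localPair L dWaveFormFactor x).conjTranspose.mul
    (PairChirality.shifts_localPair L dWaveFormFactor (x + Torus.proj L r))
  simp only [Int.reduceNeg, neg_neg, add_neg_cancel] at h
  exact h

/-- `V_r = ½ (O_r + O_rᴴ)` conserves `N↑` and `N↓`. [cite: LiebPRL1989, Remark (2)] -/
private theorem pr1_preservesSectors_pairCorrSym (L : ℕ) [NeZero L] (r : Site 2) :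
    PreservesSectors (pairCorrSym L r) := by
  have h := pr1_shifts_pairCorrOp L r
  have h' : PairChirality.Shifts 0 0 (pairCorrOp L r)ᴴ := by simpa using h.conjTranspose
  exact ((h.add h').smul _).preservesSectors

/-- Every `pair_dd` list objective `Σᵢ λᵢ V_{rᵢ}` conserves `N↑` and `N↓`. [cite: LiebPRL1989, Remark (2)] -/
private theorem pr1_preservesSectors_pairListObjective (L : ℕ) [NeZero L] {n : ℕ} (lam : Fin n → ℝ)
    (r : Fin n → Site 2) : PreservesSectors (pairListObjective L lam r) :=
  PreservesSectors.sum fun i _ => (pr1_preservesSectors_pairCorrSym L (r i)).smul _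

/-! ## §1 The rows -/

/-- **ROW (all `S^z`)**: `16 · P̄_d(4,(2,2); ψ) ≤ −claimed.E_cert` for every normalised `14`-particle ground state `ψ` of
`hubbardTorusTT' 4 1 (-1/4) 8`, `S^z`-eigen or not (in-tree all-`S^z` edge of R2 device D31 + §0 neutrality + the energy node + the claim node).
TYPED CLAIM, reader-certified (A ∧ B of record), UNSIGNED until the referee replay 'ref-pairrows1-replay'; WEAK (4 × 4 is ED-able; finite torus, not the thermodynamic limit; the ceiling 0.8243971/site is ≈ 60× the float ED value 0.013772/site (NON-RIGOROUS orientation, kit j110329) and within ×1.5 of the Cauchy–Schwarz-type bound from the on-site pair density — near-vacuous as a bound; its content is the measured METHOD CEILING of d2 + eom4, R3-DESIGN §26; no dichotomy attempted; R3 NOT reached). HONEST FRAMING: ladder R1–R4 with certified numbers; no claim on H/H₀. [cite: WangEtAl2024, §3 eq. (obsopt)] [cite: QinEtAl2020, §II eqs. (2)–(4)] -/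
theorem sixteen_mul_avgPairCorr22_le_of_claims_four_N14_U8_tpm1o4 {ψ : Fock (Orb (FermionTorus 2 4))}
    (hψ : IsGroundState (hubbardTorusTT' 4 1 (-1/4) 8) 14 ψ) (hψ1 : star ψ ⬝ᵥ ψ = 1)
    (h : torusTTUpper_tup_4x4_U8_N14_tpm1o4) (hc : pairrowsPDDup_engA_4x4_U8_N14_tpm1o4) :
    16 * avgPairCorr 4 ![2, 2] ψ ≤ -((-7973079329042861096893575 : ℝ) / 2 ^ 79) := by
  have h1 := re_expect_ge_of_sectorObsCertsTT' (groundEnergy_hubbardTorusTT'_four_N14_U8_tpm1o4_le_of_claim h)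
    (pr1_preservesSectors_pairListObjective 4 _ _) hc hψ hψ1
  rw [expect, re_expect_pairListObjective_single 3, ← sq_mul_avgPairCorr 3] at h1
  norm_num at h1 ⊢
  linarith

/-- Display form, outward 7-dp rounding: `P̄_d(4,(2,2); ψ) ≤ 0.8243971` for every normalised `14`-particle ground state (all `S^z`). HONEST FRAMING: ladder R1–R4 with certified numbers; no claim on H/H₀.
[cite: QinEtAl2020, §II eqs. (2)–(4)] -/
theorem avgPairCorr22_le_of_claims_four_N14_U8_tpm1o4_7dp {ψ : Fock (Orb (FermionTorus 2 4))}
    (hψ : IsGroundState (hubbardTorusTT' 4 1 (-1/4) 8) 14 ψ) (hψ1 : star ψ ⬝ᵥ ψ = 1)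
    (h : torusTTUpper_tup_4x4_U8_N14_tpm1o4) (hc : pairrowsPDDup_engA_4x4_U8_N14_tpm1o4) :
    avgPairCorr 4 ![2, 2] ψ ≤ (0.8243971 : ℝ) := by
  have h1 := sixteen_mul_avgPairCorr22_le_of_claims_four_N14_U8_tpm1o4 hψ hψ1 h hc
  have h2 : -((-7973079329042861096893575 : ℝ) / 2 ^ 79) ≤ 16 * (0.8243971 : ℝ) := by norm_num
  norm_num at h1 h2 ⊢
  linarith

/-- **`S^z = 0`-SECTOR reading of the same certificate** (`M = 0` member; #116 `TorusSectorObsCertTT'.re_expect_ge`; energy hypothesis from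
the node `torusTTUpper_tup_4x4_U8_N14_tpm1o4` via Lieb's `S^z = 0` representative): `16 · P̄_d(4,(2,2); ψ) ≤ −claimed.E_cert` for every normalised
ground state `ψ` of the joint sector `(N = 14, S^z = 0)` of `hubbardTorusTT' 4 1 (-1/4) 8`. TYPED CLAIM, reader-certified (A ∧ B of record), UNSIGNED until the referee replay 'ref-pairrows1-replay'; WEAK (4 × 4 is ED-able; finite torus, not the thermodynamic limit; the ceiling 0.8243971/site is ≈ 60× the float ED value 0.013772/site (NON-RIGOROUS orientation, kit j110329) and within ×1.5 of the Cauchy–Schwarz-type bound from the on-site pair density — near-vacuous as a bound; its content is the measured METHOD CEILING of d2 + eom4, R3-DESIGN §26; no dichotomy attempted; R3 NOT reached). HONEST FRAMING: ladder R1–R4 with certified numbers; no claim on H/H₀.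
[cite: QinEtAl2020, §II eqs. (2)–(4)] [cite: LiebPRL1989] -/
theorem sixteen_mul_avgPairCorr22_le_of_claims_sz0_four_N14_U8_tpm1o4 (ψ : Fock (Orb (FermionTorus 2 4))) (hψ1 : star ψ ⬝ᵥ ψ = 1)
    (hgs : IsGroundStateInSector (hubbardTorusTT' 4 1 (-1/4) 8) 14 0 ψ)
    (h : torusTTUpper_tup_4x4_U8_N14_tpm1o4) (hc : pairrowsPDDup_engA_4x4_U8_N14_tpm1o4) :
    16 * avgPairCorr 4 ![2, 2] ψ ≤ -((-7973079329042861096893575 : ℝ) / 2 ^ 79) := by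
  have hE : (hubbardTorusTT' 4 1 (-1/4) 8).minEnergyOn (szSector 14 0) ≤ ((-6757592964053 : ℝ) / 2 ^ 39) :=
    minEnergyOn_szSector_le_of_groundEnergy_rect_le (L := 4) 1 (-1/4) 8 (nh := 7) seven_le_card_fermionTorus_four
      (groundEnergy_tt_4x4_U8_N14_tpm1o4_le_of_claim h)
  have h1 := (hc 0).some.re_expect_ge hE ψ hψ1 hgs
  rw [re_expect_pairListObjective_single 3, ← sq_mul_avgPairCorr 3] at h1
  norm_num at h1 ⊢
  linarith

end Summit.HubbardSuperconductivity.HubbardLadder
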